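/-
Origin: expansion seat `planner-pub-hodgecm-prl1-g3-0`, handover #10 2026-08-18T06:28:44Z (`HOME/pub-hodgecm-prl1-g3/lean/Prl1g3/DiscretePartMaximal.lean`, md5 261ba2ba, 163 lines);
landed by the gen-7 packager in gate run 25 as `HodgeCM/Automorphic/DiscretePartMaximal.lean` (import ^import Prl1g3\.→import HodgeCM.Automorphic. ×1).
-/
/-
Copyright: HodgeCMPerL adjudication package. WIP seat prl1-g3 (planner-pub-hodgecm-prl1-g3-0), file 11.
-/
import Summits.HodgeConjecture.HodgeCM.Automorphic.DiscretePart

/-!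
# The discrete part is the LARGEST discretely decomposable part; its orthogonal complement carries no irreducible

Complement to `DiscretePart.lean` (file 7), adversary-proofing the choice `HG := discPart R_U` as the model of the
`G_U`-side space: nothing of the discrete spectrum is lost, and nothing outside it could carry a `τ`-isotypic
decomposition.  For a representation `R : G →* (H →L[ℂ] H)` and ANY invariant subspace `D`:

* `isIrreducible_map_subtype` — an irreducible closed invariant subspace of the restriction `restrictHom D hD`
  (with `D` closed) pushes forward to an irreducible closed invariant subspace of `R`; hence
  `map_subtype_le_discPart` — it lies in `discPart R`;
* **`le_discPart_of_discreteDecomp`** (maximality) — if `D` is closed and the restriction of `R` to `D` is the closed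
  span of its irreducible closed invariant subspaces, then `D ≤ discPart R`;
* `contPart R := (discPart R)ᗮ` — the CONTINUOUS PART: closed, invariant when `R` is unitary
  (`contPart_invariant`), complementary (`isCompl_discPart_contPart`, `H` complete), and
  **`isEmpty_irr_contPart`** — the restriction of a unitary `R` to `contPart R` has NO irreducible closed invariant
  subspace (`IsEmpty (Irr (contRep hR))`); equivalently every irreducible of `R` is orthogonal to `contPart R`.

Kernel-checked, no hypotheses beyond unitarity where stated; imports file 7 only.
-/

noncomputable section

open scoped Topology InnerProductSpace

namespace HodgeCM
namespace RepDecomp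

open HodgeCM.PerL34 HodgeCM.PerL34.Spectral

variable {H : Type*} [NormedAddCommGroup H] [InnerProductSpace ℂ H]
variable {G : Type*} [Group G] {R : G →* (H →L[ℂ] H)}

/-! ## 1. Push-forward of irreducibles from an arbitrary closed invariant subspace -/

section Push

variable {D : Submodule ℂ H} (hD : Invariant R D)

/-- (Ported verbatim from the HodgeCMPerL package; no docstring in the source.) -/
theorem isClosed_map_subtype_of_isClosed (hDc : IsClosed (D : Set H)) {W : Submodule ℂ D}
    (hW : IsClosed (W : Set D)) : IsClosed (W.map D.subtype : Set H) := by
  rw [Submodule.map_coe]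
  exact hDc.isClosedEmbedding_subtypeVal.isClosedMap _ hW

include hD in
/-- (Ported verbatim from the HodgeCMPerL package; no docstring in the source.) -/
theorem map_subtype_invariant_of_invariant {W : Submodule ℂ D} (hW : Invariant (restrictHom D hD) W) :
    Invariant R (W.map D.subtype) := by
  rintro g _ ⟨w, hw, rfl⟩
  exact ⟨restrictHom D hD g w, hW g w hw, rfl⟩

include hD in
/-- (Ported verbatim from the HodgeCMPerL package; no docstring in the source.) -/
theorem comap_subtype_invariant {V : Submodule ℂ H} (hV : Invariant R V) :
    Invariant (restrictHom D hD) (V.comap D.subtype) :=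
  fun g v hv => by
    change R g (v : H) ∈ V
    exact hV g _ hv

/-- **An irreducible of the restriction to a closed invariant `D` pushes forward to an irreducible of `R`.** -/
theorem isIrreducible_map_subtype (hDc : IsClosed (D : Set H)) (W : Irr (restrictHom D hD)) :
    IsIrreducible R (W.1.map D.subtype) where
  isClosed := isClosed_map_subtype_of_isClosed hDc W.2.isClosed
  invariant := map_subtype_invariant_of_invariant hD W.2.invariant
  ne_bot := by
    intro h
    apply W.2.ne_bot
    have hinj : Function.Injective D.subtype := Subtype.val_injective
    rw [← Submodule.comap_map_eq_of_injective hinj W.1, h, Submodule.comap_bot, Submodule.ker_subtype]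
  irred V hVle hVc hVinv := by
    have hinj : Function.Injective D.subtype := Subtype.val_injective
    have hVD : V ≤ D := hVle.trans (Submodule.map_subtype_le D W.1)
    have hVeq : (V.comap D.subtype).map D.subtype = V := by
      rw [Submodule.map_comap_subtype, inf_eq_right.mpr hVD]
    -- pull `V` back to `D`: a closed invariant subspace of `W`
    have hle : V.comap D.subtype ≤ W.1 := by
      rw [← Submodule.comap_map_eq_of_injective hinj W.1]
      exact Submodule.comap_mono hVle
    rcases W.2.irred (V.comap D.subtype) hle (hVc.preimage continuous_subtype_val)
        (comap_subtype_invariant hD hVinv) with h | h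
    · left
      rw [← hVeq, h, Submodule.map_bot]
    · right
      rw [← hVeq, h]

/-- … hence lies in the discrete part. -/
theorem map_subtype_le_discPart (hDc : IsClosed (D : Set H)) (W : Irr (restrictHom D hD)) :
    W.1.map D.subtype ≤ discPart R :=
  le_discPart R ⟨_, isIrreducible_map_subtype hD hDc W⟩

/-- **Maximality of the discrete part.**  A closed invariant subspace on which `R` decomposes discretely lies in
`discPart R`. -/
theorem le_discPart_of_discreteDecomp (hDc : IsClosed (D : Set H))
    (hdisc : (⨆ W : Irr (restrictHom D hD), (W.1 : Submodule ℂ D)).topologicalClosure = ⊤) :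
    D ≤ discPart R := by
  intro x hx
  set S : Submodule ℂ D := ⨆ W : Irr (restrictHom D hD), (W.1 : Submodule ℂ D) with hS
  -- `⟨x, hx⟩` lies in the closure of `S`, whose image lies in the closed `discPart R`
  have hle : S.map D.subtype ≤ discPart R := by
    rw [hS, Submodule.map_iSup]
    exact iSup_le fun W => map_subtype_le_discPart hD hDc W
  have hx' : (⟨x, hx⟩ : D) ∈ S.topologicalClosure := by
    rw [hdisc]; trivial
  rw [← SetLike.mem_coe, Submodule.topologicalClosure_coe, closure_subtype] at hx'
  have hsub : closure (Subtype.val '' (S : Set D)) ⊆ (discPart R : Set H) := by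
    refine closure_minimal ?_ (isClosed_discPart R)
    rintro _ ⟨y, hy, rfl⟩
    exact hle ⟨y, hy, rfl⟩
  exact hsub hx'

end Push

/-! ## 2. The continuous part -/

variable (R) in
/-- The **continuous part**: the orthogonal complement of the discrete part. -/
def contPart : Submodule ℂ H := (discPart R)ᗮ

/-- (Ported verbatim from the HodgeCMPerL package; no docstring in the source.) -/
theorem isClosed_contPart : IsClosed (contPart R : Set H) := Submodule.isClosed_orthogonal _

/-- (Ported verbatim from the HodgeCMPerL package; no docstring in the source.) -/
theorem contPart_invariant (hR : IsUnitaryRep R) : Invariant R (contPart R) :=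
  (discPart_invariant R).orthogonal hR

/-- (Ported verbatim from the HodgeCMPerL package; no docstring in the source.) -/
theorem isCompl_discPart_contPart [CompleteSpace H] : IsCompl (discPart R) (contPart R) := by
  haveI : CompleteSpace (discPart R) := (isClosed_discPart R).completeSpace_coe
  exact (discPart R).isCompl_orthogonal

/-- The representation restricted to its continuous part. -/
def contRep (hR : IsUnitaryRep R) : G →* (contPart R →L[ℂ] contPart R) :=
  restrictHom (contPart R) (contPart_invariant hR)

/-- (Ported verbatim from the HodgeCMPerL package; no docstring in the source.) -/
theorem isUnitaryRep_contRep (hR : IsUnitaryRep R) : IsUnitaryRep (contRep hR) :=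
  isUnitaryRep_restrictHom hR _ _

/-- **Every irreducible of `R` is orthogonal to the continuous part.** -/
theorem irr_le_orthogonal_contPart (V : Irr R) : (V.1 : Submodule ℂ H) ≤ (contPart R)ᗮ :=
  (le_discPart R V).trans (Submodule.le_orthogonal_orthogonal _)

/-- **The continuous part carries NO irreducible closed invariant subspace.** -/
theorem isEmpty_irr_contPart (hR : IsUnitaryRep R) : IsEmpty (Irr (contRep hR)) := by
  refine ⟨fun W => W.2.ne_bot ?_⟩
  have h1 : W.1.map (contPart R).subtype ≤ discPart R :=
    map_subtype_le_discPart (contPart_invariant hR) isClosed_contPart W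
  have h2 : W.1.map (contPart R).subtype ≤ contPart R := Submodule.map_subtype_le _ _
  have h0 : W.1.map (contPart R).subtype = ⊥ := by
    rw [eq_bot_iff]
    intro v hv
    have : v ∈ discPart R ⊓ (discPart R)ᗮ := ⟨h1 hv, h2 hv⟩
    rwa [Submodule.inf_orthogonal_eq_bot] at this
  have hinj : Function.Injective (contPart R).subtype := Subtype.val_injective
  rw [← Submodule.comap_map_eq_of_injective hinj W.1, h0, Submodule.comap_bot, Submodule.ker_subtype]

/-- Equivalently: the span of the irreducibles of the continuous part is `⊥` (so a `τ`-isotypic decomposition of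
anything larger than the discrete part is impossible). -/
theorem iSup_irr_contRep_eq_bot (hR : IsUnitaryRep R) :
    (⨆ W : Irr (contRep hR), (W.1 : Submodule ℂ (contPart R))) = ⊥ := by
  haveI := isEmpty_irr_contPart hR
  exact iSup_of_empty _

end RepDecomp
end HodgeCM
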